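import Mathlib
import Summits.ValiantsHypothesis.ValiantsHypothesis.Theorems.BarrierLeverPartitionMinorsHitByVPHiddenStatesSecondShellNestedRows
import Summits.ValiantsHypothesis.ValiantsHypothesis.Theorems.BarrierLeverPartitionMinorsHitByVPHiddenStatesSecondShellPrescribed
import Summits.ValiantsHypothesis.ValiantsHypothesis.Theorems.BarrierLeverPartitionMinorsHitByVPHiddenStatesSecondShellCrossTemplate
import Summits.ValiantsHypothesis.ValiantsHypothesis.Theorems.BarrierLeverPartitionMinorsHitByVPHiddenStatesSecondShellChainFour
import Summits.ValiantsHypothesis.ValiantsHypothesis.Theorems.BarrierLeverPartitionMinorsHitByVPHiddenStatesSecondShellPathReads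

/-!
# Route BarrierLever — item `PartitionMinorsHitByVP` (stmt-ValiantsHypothesis-19717), line `hidden-states`:
# ★★ THE CROSSED (3,3) CELL — `Y₁ = {p,q,u}`, `Y₂ = {p,q,v}`, `u ∈ A₂ ∩ C₂`, `v ∈ A₁ ∩ C₁` (every `t, h`)

Helper file (`--supports stmt-ValiantsHypothesis-19717`; cell valiant-natproofs, 𝒟-side door (c), registered line
`Cruxes/PartitionMinorsHitByVP/Lines/hidden_states.lean` v8; prover seat val-np-p6 gen 18).  Closes NO item; definition-free.

THE CLASS (gen 17 memo §4d «four movers», the largest uncovered t = 4 shapes).  `C₁∖A₁ = {p, q, u}`, `C₂∖A₂ = {p, q, v}` with the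
private node of each swap INERT in the other: `u ∈ A₂ ∩ C₂`, `v ∈ A₁ ∩ C₁`.  Orient path 1 = (u < p < q) (attachments `x₀, x₁` at
`u`) and path 2 = (p < q < v) (attachments `f₀, f₁` at `p`).  The cross minor `D_{B − A₁ + C₂}` has the start row
`C₂ = Z ∪ {u, p, q, v}`, `Z = (A₂ ∩ C₂) ∖ {u}`, whose FOUR movers form the chain `v → q → p → u` (`u` reads `x₀, x₁`; `p` reads `u`
and `f₀, f₁`; `q` reads `p`; `v` reads `q`).  By the FOUR-MOVER CHAIN LEMMA (`…SecondShellChainFour.det_eq_zero_of_chain₄`) the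
rows that must be present either contain one of `u, p, q ∉ A₁`, or are small, or are `Z ∪ {v, x₀, x₁}` / `Z ∪ {f_j, x₀, x₁}` —
and `Z ∪ T = A₁` with `x₀, x₁ ∉ Z` forces `Z ⊆ A₁ ∩ C₁`, whence `C₂ ⊆ C₁`, i.e. `C₁ = C₂`, excluded.  ★★
`exists_table_secondShell_crossed`.  EXACT t = 4 CENSUS (kit j322364): shapes ((3,3),2,0,2,2) (45 360 families) and
((3,3),2,1,2,2) (22 680) of B₄(9).

HONEST LABEL: conjecture-column cell (second shell, every `t, h`); 19717 stays OPEN; nothing on crux 14610 or VP ≠ VNP.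
-/

set_option linter.dupNamespace false

namespace Summit.ValiantsHypothesis.ValiantsHypothesis.Theorems.BarrierLever.HiddenStates

open Finset

noncomputable section

namespace SecondShell

open PathTable

/-! ## ★★ The crossed (3,3) cell -/

set_option maxHeartbeats 400000 in
/-- ★★ **SECOND SHELL, CROSSED (3,3) CLASSES, EVERY `t, h`.**  `C₁∖A₁ = {p,q,u}`, `C₂∖A₂ = {p,q,v}`, `u ∈ A₂ ∩ C₂`,
`v ∈ A₁ ∩ C₁`: the class is served by a two-parameter path table. -/
theorem exists_table_secondShell_crossed (h t : ℕ) (A₁ A₂ C₁ C₂ : Finset (Fin h))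
    (hA₁ : A₁.card = t) (hA₂ : A₂.card = t) (hC₁ : C₁.card = t + 1) (hC₂ : C₂.card = t + 1)
    (h₁ : ¬ A₁ ⊆ C₁) (h₂ : ¬ A₂ ⊆ C₂) (hA : A₁ ≠ A₂) (hC : C₁ ≠ C₂)
    {yp yq yu yv : Fin h}
    (hY₁ : C₁ \ A₁ = {yp, yq, yu}) (hY₂ : C₂ \ A₂ = {yp, yq, yv}) (hpq : yp ≠ yq) (hpu : yp ≠ yu) (hqu : yq ≠ yu)
    (hpv : yp ≠ yv) (hqv : yq ≠ yv) (huv : yu ≠ yv) (huA : yu ∈ A₂) (huC : yu ∈ C₂) (hvA : yv ∈ A₁) (hvC : yv ∈ C₁)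
    {r : ℕ} (u cols : Fin r → Finset (Fin h)) (hu : Function.Injective u)
    (hU : ∀ i, ((u i).card ≤ t ∧ u i ≠ A₁ ∧ u i ≠ A₂) ∨ u i = C₁ ∨ u i = C₂)
    (hcols : ∀ J : Finset (Fin h), J.card ≤ t → ∃ kk, cols kk = J) :
    ∃ tx : Option (Fin h) → Fin h → ℂ,
      (Matrix.of fun i kk : Fin r => ∏ a ∈ u i, (tx none a + ∑ q ∈ cols kk, tx (some q) a)).det ≠ 0 := by
  classical
  obtain ⟨k₁, j₁, j₁', hk₁, hkj₁, a1, a2, a3, a4⟩ := swap_sizes A₁ C₁ hA₁ hC₁ h₁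
  obtain ⟨k₂, j₂, j₂', hk₂, hkj₂, b1, b2, b3, b4⟩ := swap_sizes A₂ C₂ hA₂ hC₂ h₂
  have hY₁c : (C₁ \ A₁).card = 3 := by
    rw [hY₁, Finset.card_insert_of_notMem (by simp [hpq, hpu]), Finset.card_pair hqu]
  have hY₂c : (C₂ \ A₂).card = 3 := by
    rw [hY₂, Finset.card_insert_of_notMem (by simp [hpq, hpv]), Finset.card_pair hqv]
  obtain rfl : k₁ = 2 := by omega
  obtain rfl : k₂ = 2 := by omega
  -- membership facts
  have hyp₁ : yp ∈ C₁ \ A₁ := by rw [hY₁]; simp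
  have hyq₁ : yq ∈ C₁ \ A₁ := by rw [hY₁]; simp
  have hyu₁ : yu ∈ C₁ \ A₁ := by rw [hY₁]; simp
  have hyp₂ : yp ∈ C₂ \ A₂ := by rw [hY₂]; simp
  have hyq₂ : yq ∈ C₂ \ A₂ := by rw [hY₂]; simp
  have hyv₂ : yv ∈ C₂ \ A₂ := by rw [hY₂]; simp
  obtain ⟨⟨hypC₁, hypA₁⟩, ⟨hyqC₁, hyqA₁⟩, ⟨hyuC₁, hyuA₁⟩⟩ :=
    And.intro (Finset.mem_sdiff.1 hyp₁) (And.intro (Finset.mem_sdiff.1 hyq₁) (Finset.mem_sdiff.1 hyu₁))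
  obtain ⟨⟨hypC₂, hypA₂⟩, ⟨hyqC₂, hyqA₂⟩, ⟨hyvC₂, hyvA₂⟩⟩ :=
    And.intro (Finset.mem_sdiff.1 hyp₂) (And.intro (Finset.mem_sdiff.1 hyq₂) (Finset.mem_sdiff.1 hyv₂))
  -- attachments
  obtain ⟨x₀, x₁, hx, hX₁⟩ := Finset.card_eq_two.1 a2
  obtain ⟨f₀, f₁, hf, hX₂⟩ := Finset.card_eq_two.1 b2
  have hx₀ : x₀ ∈ A₁ \ C₁ := by rw [hX₁]; simp
  have hx₁ : x₁ ∈ A₁ \ C₁ := by rw [hX₁]; simp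
  have hf₀ : f₀ ∈ A₂ \ C₂ := by rw [hX₂]; simp
  have hf₁ : f₁ ∈ A₂ \ C₂ := by rw [hX₂]; simp
  -- transports: path 1 = (u < p < q), x₀, x₁ at u; path 2 = (p < q < v), f₀, f₁ at p
  have hmemY₁ : ∀ i, ![yu, yp, yq] i ∈ C₁ \ A₁ := by
    intro i; fin_cases i
    · exact hyu₁
    · exact hyp₁
    · exact hyq₁
  have hmemX₁ : ∀ i, ![x₀, x₁] i ∈ A₁ \ C₁ := by
    intro i; fin_cases i
    · exact hx₀
    · exact hx₁
  have hmemY₂ : ∀ i, ![yp, yq, yv] i ∈ C₂ \ A₂ := by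
    intro i; fin_cases i
    · exact hyp₂
    · exact hyq₂
    · exact hyv₂
  have hmemX₂ : ∀ i, ![f₀, f₁] i ∈ A₂ \ C₂ := by
    intro i; fin_cases i
    · exact hf₀
    · exact hf₁
  obtain ⟨e₁, m1, m2, m3, m4, hpy₁, hpx₁⟩ := exists_equiv_prescribed A₁ C₁ a1 a2 a3 a4 _
    (injective_vec3 hpu.symm hqu.symm hpq) hmemY₁ _ (injective_vec2 hx) hmemX₁
  obtain ⟨e₂, n1, n2, n3, n4, hpy₂, hpx₂⟩ := exists_equiv_prescribed A₂ C₂ b1 b2 b3 b4 _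
    (injective_vec3 hpq hpv hqv) hmemY₂ _ (injective_vec2 hf) hmemX₂
  have he₁u : e₁ (Sum.inl (Sum.inl 0)) = yu := by rw [hpy₁]; rfl
  have he₁p : e₁ (Sum.inl (Sum.inl 1)) = yp := by rw [hpy₁]; rfl
  have he₁q : e₁ (Sum.inl (Sum.inl 2)) = yq := by rw [hpy₁]; rfl
  have he₁x₀ : e₁ (Sum.inl (Sum.inr 0)) = x₀ := by rw [hpx₁]; rfl
  have he₁x₁ : e₁ (Sum.inl (Sum.inr 1)) = x₁ := by rw [hpx₁]; rfl
  have he₂p : e₂ (Sum.inl (Sum.inl 0)) = yp := by rw [hpy₂]; rfl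
  have he₂q : e₂ (Sum.inl (Sum.inl 1)) = yq := by rw [hpy₂]; rfl
  have he₂v : e₂ (Sum.inl (Sum.inl 2)) = yv := by rw [hpy₂]; rfl
  have he₂f₀ : e₂ (Sum.inl (Sum.inr 0)) = f₀ := by rw [hpx₂]; rfl
  have he₂f₁ : e₂ (Sum.inl (Sum.inr 1)) = f₁ := by rw [hpx₂]; rfl
  refine exists_table_secondShell_of_cross h t A₁ A₂ C₁ C₂ hA₁ hA₂ hC₁ hC₂ hA hC hk₁ hkj₁ hk₂ hkj₂ e₁ m1 m2 m3 m4
    e₂ n1 n2 n3 n4 u cols hu hU hcols (Or.inl ?_)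
  intro rows i₀ hrow₀ key hcolcard ε
  -- table facts
  have R₁ := fun d => path₂_reads e₁ he₁u he₁p he₁q he₁x₀ he₁x₁ d
  have R₂ := fun d => path₂_reads e₂ he₂p he₂q he₂v he₂f₀ he₂f₁ d
  obtain ⟨v₁up, v₁uq, v₁pq, v₁qu⟩ := path₂_zeros e₁ he₁u he₁p he₁q
  obtain ⟨v₂pq, v₂pv, v₂qv, v₂vp⟩ := path₂_zeros e₂ he₂p he₂q he₂v
  have v₂u : ∀ d, swapTable' e₂ yu d = if d = yu then 1 else 0 :=
    row_unit A₂ C₂ e₂ n1 (fun h' => (Finset.mem_sdiff.1 h').2 huA)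
  have v₁v : ∀ d, swapTable' e₁ yv d = if d = yv then 1 else 0 :=
    row_unit A₁ C₁ e₁ m1 (fun h' => (Finset.mem_sdiff.1 h').2 hvA)
  have v₁uv : swapTable' e₁ yu yv = 0 := by
    by_contra h'
    rcases (R₁ yv).1 h' huv.symm with h | h
    · exact (Finset.mem_sdiff.1 hx₀).2 (h ▸ hvC)
    · exact (Finset.mem_sdiff.1 hx₁).2 (h ▸ hvC)
  have v₁pv : swapTable' e₁ yp yv = 0 := by by_contra h'; exact huv.symm ((R₁ yv).2.1 h' hpv.symm)
  have v₁qv : swapTable' e₁ yq yv = 0 := by by_contra h'; exact hpv.symm ((R₁ yv).2.2 h' hqv.symm)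
  have v₂qu : swapTable' e₂ yq yu = 0 := by by_contra h'; exact hpu.symm ((R₂ yu).2.1 h' hqu.symm)
  have v₂vu : swapTable' e₂ yv yu = 0 := by by_contra h'; exact hqu.symm ((R₂ yu).2.2 h' huv)
  have hunit : ∀ d, d ∈ A₁ \ C₁ ∨ d ∈ A₂ \ C₂ → ∀ q, swapTable' e₁ d q = (if q = d then 1 else 0) ∧
      swapTable' e₂ d q = (if q = d then 1 else 0) := by
    intro d hd q
    have hd₁ : d ∉ C₁ \ A₁ := by
      rcases hd with hd | hd
      · exact fun h' => (Finset.mem_sdiff.1 h').2 (Finset.mem_sdiff.1 hd).1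
      · intro h'
        rw [hY₁] at h'
        simp only [Finset.mem_insert, Finset.mem_singleton] at h'
        rcases h' with rfl | rfl | rfl
        · exact (Finset.mem_sdiff.1 hd).2 hypC₂
        · exact (Finset.mem_sdiff.1 hd).2 hyqC₂
        · exact (Finset.mem_sdiff.1 hd).2 huC
    have hd₂ : d ∉ C₂ \ A₂ := by
      rcases hd with hd | hd
      · intro h'
        rw [hY₂] at h'
        simp only [Finset.mem_insert, Finset.mem_singleton] at h'
        rcases h' with rfl | rfl | rfl
        · exact (Finset.mem_sdiff.1 hd).2 hypC₁
        · exact (Finset.mem_sdiff.1 hd).2 hyqC₁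
        · exact (Finset.mem_sdiff.1 hd).2 hvC
      · exact fun h' => (Finset.mem_sdiff.1 h').2 (Finset.mem_sdiff.1 hd).1
    exact ⟨row_unit A₁ C₁ e₁ m1 hd₁ q, row_unit A₂ C₂ e₂ n1 hd₂ q⟩
  -- the combined table and what the movers read in it
  set w : Fin h → Fin h → ℂ := tab2 (fun a q => swapTable' e₁ a q - if q = a then 1 else 0)
      (fun a q => swapTable' e₂ a q - if q = a then 1 else 0) ε with hw
  have hwdef : ∀ y q, w y q = (if q = y then 1 else 0) + ε 0 * (swapTable' e₁ y q - if q = y then 1 else 0)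
      + ε 1 * (swapTable' e₂ y q - if q = y then 1 else 0) := fun y q => rfl
  have hoff : ∀ y d, d ≠ y → w y d ≠ 0 → swapTable' e₁ y d ≠ 0 ∨ swapTable' e₂ y d ≠ 0 := by
    intro y d hdy hw0
    by_contra hcon
    push Not at hcon
    apply hw0
    rw [hwdef, hcon.1, hcon.2, if_neg hdy]; ring
  have hreadu : ∀ d, d ≠ yu → w yu d ≠ 0 → d = x₀ ∨ d = x₁ := by
    intro d hd hw0
    rcases hoff yu d hd hw0 with h' | h'
    · exact (R₁ d).1 h' hd
    · exfalso; apply h'; rw [v₂u d, if_neg hd]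
  have hreadp : ∀ d, d ≠ yp → w yp d ≠ 0 → d = yu ∨ d = f₀ ∨ d = f₁ := by
    intro d hd hw0
    rcases hoff yp d hd hw0 with h' | h'
    · exact Or.inl ((R₁ d).2.1 h' hd)
    · exact Or.inr ((R₂ d).1 h' hd)
  have hreadq : ∀ d, d ≠ yq → w yq d ≠ 0 → d = yp := by
    intro d hd hw0
    rcases hoff yq d hd hw0 with h' | h'
    · exact (R₁ d).2.2 h' hd
    · exact (R₂ d).2.1 h' hd
  have hreadv : ∀ d, d ≠ yv → w yv d ≠ 0 → d = yq := by
    intro d hd hw0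
    rcases hoff yv d hd hw0 with h' | h'
    · exfalso; apply h'; rw [v₁v d, if_neg hd]
    · exact (R₂ d).2.2 h' hd
  -- the inert part `Z = (A₂ ∩ C₂) ∖ {u}` of the start row `C₂`
  obtain ⟨Z, hZdef⟩ : ∃ Z : Finset (Fin h), Z = (A₂ ∩ C₂).erase yu := ⟨_, rfl⟩
  have huZ₂ : yu ∈ A₂ ∩ C₂ := Finset.mem_inter.2 ⟨huA, huC⟩
  have hZsub : Z ⊆ A₂ ∩ C₂ := by rw [hZdef]; exact Finset.erase_subset _ _
  have hZc : Z.card + 3 = t := by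
    have := Finset.card_pos.2 ⟨yu, huZ₂⟩
    rw [hZdef, Finset.card_erase_of_mem huZ₂, b3]; rw [b3] at this; omega
  have huZ : yu ∉ Z := by rw [hZdef]; exact Finset.notMem_erase _ _
  have hZ₂eq : A₂ ∩ C₂ = insert yu Z := by rw [hZdef, Finset.insert_erase huZ₂]
  have hyZ : ∀ y, y ∉ A₂ → y ∉ Z := fun y hy h' => hy (Finset.mem_inter.1 (hZsub h')).1
  have hpZ := hyZ yp hypA₂
  have hqZ := hyZ yq hyqA₂
  have hvZ := hyZ yv hyvA₂
  have hM4 : ∀ d, d ∉ ({yu, yp, yq, yv} : Finset (Fin h)) ↔ d ≠ yu ∧ d ≠ yp ∧ d ≠ yq ∧ d ≠ yv := by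
    intro d; simp only [Finset.mem_insert, Finset.mem_singleton, not_or]
  have hexit : ∀ d, d ≠ yu → d ≠ yp → d ≠ yq → d ≠ yv → (w yu d ≠ 0 ∨ w yp d ≠ 0 ∨ w yq d ≠ 0 ∨ w yv d ≠ 0) →
      d ∈ A₁ \ C₁ ∨ d ∈ A₂ \ C₂ := by
    intro d hdu hdp hdq hdv hread
    rcases hread with h' | h' | h' | h'
    · rcases hreadu d hdu h' with rfl | rfl
      · exact Or.inl hx₀
      · exact Or.inl hx₁
    · rcases hreadp d hdp h' with h | rfl | rfl
      · exact absurd h hdu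
      · exact Or.inr hf₀
      · exact Or.inr hf₁
    · exact absurd (hreadq d hdq h') hdp
    · exact absurd (hreadv d hdv h') hdq
  -- rows through `u`, `p` or `q`, and small rows, are present; `Z ∪ T = A₁` with `x₀, x₁ ∉ Z` forces `C₁ = C₂`
  have hmov : ∀ S : Finset (Fin h), S.card ≤ t → (∃ y ∈ S, y ∉ A₁) → ∃ i, i ≠ i₀ ∧ rows i = S :=
    fun S hS ⟨y, hyS, hyA⟩ => key S hS fun hSA => hyA (hSA ▸ hyS)
  have hcardT : ∀ T : Finset (Fin h), Disjoint T Z → T.card ≤ 3 → (T ∪ Z).card ≤ t := fun T hT hT3 => by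
    rw [Finset.card_union_of_disjoint hT]; omega
  have hdisj3 : ∀ p q s : Fin h, p ∉ Z → q ∉ Z → s ∉ Z → Disjoint ({p, q, s} : Finset (Fin h)) Z := by
    intro p q s hp hq hs
    rw [Finset.disjoint_insert_left, Finset.disjoint_insert_left, Finset.disjoint_singleton_left]; exact ⟨hp, hq, hs⟩
  have hrow3 : ∀ p q s : Fin h, p ∉ A₁ → p ∉ Z → q ∉ Z → s ∉ Z → ∃ i, i ≠ i₀ ∧ rows i = {p, q, s} ∪ Z := by
    intro p q s hpA hp hq hs
    exact hmov _ (hcardT _ (hdisj3 p q s hp hq hs) Finset.card_le_three) ⟨p, Finset.mem_union_left _ (by simp), hpA⟩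
  have hnoX : ∀ S : Finset (Fin h), S ∪ Z = A₁ → x₀ ∉ Z → x₁ ∉ Z → False := by
    intro S hEq hx₀Z hx₁Z
    have hsub : C₂ ⊆ C₁ := by
      intro x hx
      by_cases hxA : x ∈ A₂
      · by_cases hxu : x = yu
        · exact hxu ▸ hyuC₁
        · have hxZ : x ∈ Z := by rw [hZdef]; exact Finset.mem_erase.2 ⟨hxu, Finset.mem_inter.2 ⟨hxA, hx⟩⟩
          have hxA₁ : x ∈ A₁ := by rw [← hEq]; exact Finset.mem_union_right _ hxZ
          by_contra hxC₁
          have hxX : x ∈ A₁ \ C₁ := Finset.mem_sdiff.2 ⟨hxA₁, hxC₁⟩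
          rw [hX₁, Finset.mem_insert, Finset.mem_singleton] at hxX
          rcases hxX with rfl | rfl
          · exact hx₀Z hxZ
          · exact hx₁Z hxZ
      · have hxY : x ∈ C₂ \ A₂ := Finset.mem_sdiff.2 ⟨hx, hxA⟩
        rw [hY₂] at hxY
        simp only [Finset.mem_insert, Finset.mem_singleton] at hxY
        rcases hxY with rfl | rfl | rfl
        · exact hypC₁
        · exact hyqC₁
        · exact hvC
    exact hC (Finset.eq_of_subset_of_card_le hsub (by rw [hC₁, hC₂])).symm
  have hXpair : ∀ d d' : Fin h, d ≠ d' → (d = x₀ ∨ d = x₁) → (d' = x₀ ∨ d' = x₁) → d ∉ Z → d' ∉ Z → x₀ ∉ Z ∧ x₁ ∉ Z := by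
    rintro d d' hne (rfl | rfl) (rfl | rfl) hd hd'
    · exact absurd rfl hne
    · exact ⟨hd, hd'⟩
    · exact ⟨hd', hd⟩
    · exact absurd rfl hne
  refine det_eq_zero_of_chain₄ w rows cols i₀ Z hpu.symm hqu.symm huv hpq hpv hqv huZ hpZ hqZ hvZ
    ?_ ?_ ?_ ?_ ?_ ?_ ?_ ?_ ?_ ?_ ?_ ?_ ?_ ?_ ?_ ?_ ?_ ?_ ?_ ?_ ?_ ?_ ?_ ?_ ?_ ?_ ?_ ?_
  · -- unit rows on `Z`
    intro z hz q
    obtain ⟨hzA, hzC⟩ := Finset.mem_inter.1 (hZsub hz)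
    have hz₂ : z ∉ C₂ \ A₂ := fun h' => (Finset.mem_sdiff.1 h').2 hzA
    have hz₁ : z ∉ C₁ \ A₁ := by
      intro h'
      rw [hY₁] at h'
      simp only [Finset.mem_insert, Finset.mem_singleton] at h'
      rcases h' with rfl | rfl | rfl
      · exact hypA₂ hzA
      · exact hyqA₂ hzA
      · exact huZ hz
    rw [hwdef, row_unit A₁ C₁ e₁ m1 hz₁ q, row_unit A₂ C₂ e₂ n1 hz₂ q]; ring
  · rw [hwdef, swapTable'_self, swapTable'_self, if_pos rfl]; ring
  · rw [hwdef, v₁up, v₂u yp, if_neg hpu]; ring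
  · rw [hwdef, v₁uq, v₂u yq, if_neg hqu]; ring
  · rw [hwdef, v₁uv, v₂u yv, if_neg huv.symm]; ring
  · rw [hwdef, swapTable'_self, swapTable'_self, if_pos rfl]; ring
  · rw [hwdef, v₁pq, v₂pq, if_neg hpq.symm]; ring
  · rw [hwdef, v₁pv, v₂pv, if_neg hpv.symm]; ring
  · rw [hwdef, swapTable'_self, swapTable'_self, if_pos rfl]; ring
  · rw [hwdef, v₁qu, v₂qu, if_neg hqu.symm]; ring
  · rw [hwdef, v₁qv, v₂qv, if_neg hqv.symm]; ring
  · rw [hwdef, swapTable'_self, swapTable'_self, if_pos rfl]; ring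
  · rw [hwdef, v₁v yu, v₂vu, if_neg huv]; ring
  · rw [hwdef, v₁v yp, v₂vp, if_neg hpv]; ring
  · -- read exits are attachments, hence unit rows
    intro d _ hdM hread q
    obtain ⟨hdu, hdp, hdq, hdv⟩ := (hM4 d).1 hdM
    have hd := hexit d hdu hdp hdq hdv hread
    rw [hwdef, (hunit d hd q).1, (hunit d hd q).2]; ring
  · -- the start row `C₂ = Z ∪ {u, p, q, v}`
    rw [hrow₀, eq_insert₃_inter hY₂, hZ₂eq]
    ext x; simp only [Finset.mem_insert]; tauto
  · intro kk; rw [hZc]; exact hcolcard kk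
  · -- small rows and mover rows
    intro T hTZ hT _
    rcases hT with hT2 | ⟨hTM, hT3⟩
    · refine key _ (hcardT T hTZ (by omega)) fun hEq => ?_
      have h1 := Finset.card_union_of_disjoint hTZ; rw [hEq, hA₁] at h1; omega
    · by_cases hT2 : T.card ≤ 2
      · refine key _ (hcardT T hTZ hT3) fun hEq => ?_
        have h1 := Finset.card_union_of_disjoint hTZ; rw [hEq, hA₁] at h1; omega
      · -- a three-element subset of `{u, p, q, v}` contains one of `u, p, q`
        have hT3' : T.card = 3 := by omega
        obtain ⟨y₁, y₂, y₃, h12, h13, h23, hTeq⟩ := Finset.card_eq_three.1 hT3'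
        have hy : ∃ y ∈ T, y ≠ yv := by
          by_cases h1 : y₁ = yv
          · exact ⟨y₂, by rw [hTeq]; simp, fun h2 => h12 (h1.trans h2.symm)⟩
          · exact ⟨y₁, by rw [hTeq]; simp, h1⟩
        obtain ⟨y, hyT, hyv⟩ := hy
        refine hmov _ (hcardT T hTZ hT3) ⟨y, Finset.mem_union_left _ hyT, ?_⟩
        have hyM := hTM hyT
        simp only [Finset.mem_insert, Finset.mem_singleton] at hyM
        rcases hyM with rfl | rfl | rfl | rfl
        · exact hyuA₁
        · exact hypA₁
        · exact hyqA₁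
        · exact absurd rfl hyv
  · intro d hdZ _ _; exact hrow3 yu yp d hyuA₁ huZ hpZ hdZ
  · intro d hdZ _ _ _; exact hrow3 yu yq d hyuA₁ huZ hqZ hdZ
  · intro d hdZ _ _; exact hrow3 yu yv d hyuA₁ huZ hvZ hdZ
  · intro d hdZ _ _ _; exact hrow3 yp yq d hypA₁ hpZ hqZ hdZ
  · intro d hdZ _ _ _; exact hrow3 yp yv d hypA₁ hpZ hvZ hdZ
  · intro d hdZ _ _; exact hrow3 yq yv d hyqA₁ hqZ hvZ hdZ
  · intro d d' _ hdZ hd'Z _ _ _ _; exact hrow3 yu d d' hyuA₁ huZ hdZ hd'Z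
  · intro d d' _ hdZ hd'Z _ _ _ _; exact hrow3 yp d d' hypA₁ hpZ hdZ hd'Z
  · -- `Z ∪ {v, d, d'}` with two `u`-exits `d, d'`: `{d, d'} = {x₀, x₁}`
    intro d d' hdd' hdZ hd'Z hdM hd'M hud hud'
    obtain ⟨hdu, -, -, -⟩ := (hM4 d).1 hdM
    obtain ⟨hd'u, -, -, -⟩ := (hM4 d').1 hd'M
    obtain ⟨hx₀Z, hx₁Z⟩ := hXpair d d' hdd' (hreadu d hdu hud) (hreadu d' hd'u hud') hdZ hd'Z
    exact key _ (hcardT _ (hdisj3 yv d d' hvZ hdZ hd'Z) Finset.card_le_three) fun hEq => hnoX _ hEq hx₀Z hx₁Z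
  · -- the pure triples: `d', d''` are two `u`-exits
    intro d d' d'' _ _ hd'd'' hdZ hd'Z hd''Z _ hd'M hd''M _ hud' hud''
    obtain ⟨hd'u, -, -, -⟩ := (hM4 d').1 hd'M
    obtain ⟨hd''u, -, -, -⟩ := (hM4 d'').1 hd''M
    obtain ⟨hx₀Z, hx₁Z⟩ := hXpair d' d'' hd'd'' (hreadu d' hd'u hud') (hreadu d'' hd''u hud'') hd'Z hd''Z
    exact key _ (hcardT _ (hdisj3 d d' d'' hdZ hd'Z hd''Z) Finset.card_le_three) fun hEq => hnoX _ hEq hx₀Z hx₁Z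

end SecondShell

end

end Summit.ValiantsHypothesis.ValiantsHypothesis.Theorems.BarrierLever.HiddenStates
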